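import Literature.AlgebraicGeometry.Resolution.HypersurfaceTransform
import HarnessLib

/-!
# The restriction property: the transform of a hypersurface of maximal contact is its blow-up (BGMW 2011, Lemma 3.6.4 (6); §4 Remark (3))

Topic: `Literature/AlgebraicGeometry/Resolution`. Bierstone–Grigoriev–Milman–Włodarczyk, *Effective
Hironaka resolution and its complexity (with appendix on applications in positive
characteristic)*, arXiv:1206.3090. **Lemma 3.6.4 (6)** (p. 8): "`V(u')` is the restriction of the
strict transform of `V(u)` to `U'`"; **§4, Remark (3)** (p. 11): "The main feature which
characterizes the notion of blow-up is the following 'restriction property': If `X` is a smooth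
variety containing a smooth subvariety `Y ⊂ X`, which contains the center `C ⊂ Y` then the
blow-up `σ_{C,Y} : Ỹ → Y` at `C` coincides with the strict transform of `Y` under the blow-up
`σ_{C,X} : X̃ → X`." This is what makes the induction on dimension work (Lemma 3.9.4 (1), (3):
blow-ups of the hypersurface of maximal contact are blow-ups of the ambient variety and
conversely).

This file PROVES the restriction property for a regular HYPERSURFACE `Y = V(H)` through the
centre, for blow-ups in the sense of the universal property (`IsBlowup`, `Blowups.lean`) and
Mathlib's closed subschemes (`Scheme.IdealSheafData.subscheme`): let `X` be locally Noetherian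
and regular, `π : X' → X` a blow-up along `C` with `V(C)` regular, `H ⊆ C` an ideal sheaf
generated at each point of `V(H)` by an element of order one, and `H' = (π^*H : 𝓘(D))` its
controlled transform (`controlledTransform π C H 1`; `V(H') = V(u')`). Then the morphism
`V(H') → V(H)` induced by `π` IS A BLOW-UP of `V(H)` along `C|_{V(H)}`
(`IsBlowup.isBlowup_subscheme_controlledTransform`). Proof from the universal property:
(a) the exceptional divisor restricts to an effective Cartier divisor on `V(H')`, because at
each point `V(H')` is the regular hypersurface `V(w)` and `w` does not divide the local equation
of `D` (`IsBlowup.exists_generator_controlledTransform_hypersurface`,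
`HypersurfaceTransform.lean`; `𝒪_{X',x'}/(w)` is a domain); (b) a morphism `f : W → V(H)`
pulling `C` back to a Cartier divisor lifts to `g : W → X'` (universal property of `π`), and `g`
lands in `V(H')` since `π^*H = 𝓘(D)·H'` (`pow_mul_controlledTransform_eq`) with `g^*𝓘(D)`
Cartier and `g^*π^*H = f^*(H|_{V(H)}) = 0` force `g^*H' = 0` (`IsEffectiveCartier.eq_bot_of_mul_eq_bot`);
uniqueness from that of `π` and the monomorphism `V(H') ↪ X'`.

Auxiliary [folklore]: `comap_ker_self`, `comap_bot`, `le_ker_iff_comap_eq_bot`,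
`IsEffectiveCartier.eq_bot_of_mul_eq_bot`, `mem_ideal_of_mul_mem_of_hypersurface` (the local
argument (a) on an affine open), `IsBlowup.isEffectiveCartier_comap_subschemeι_controlledTransform`,
`exists_hom_subscheme_controlledTransform` (the induced morphism `V(H') → V(H)` exists).

## Sources

* [BGMW 2011] §3.6 Lemma 3.6.4 (6); §4 Remarks (1)–(3) (arXiv:1206.3090, pp. 8, 11).
  [BierstoneGrigorievMilmanWlodarczyk2011]
* U. Görtz, T. Wedhorn, *Algebraic Geometry I*, 2nd ed. (2020), Prop. 13.91, Prop. 13.96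
  (strict transforms as blow-ups) — background. [GortzWedhorn2020]
-/

noncomputable section

open CategoryTheory CategoryTheory.Limits AlgebraicGeometry TopologicalSpace IsLocalRing

namespace Literature.AlgebraicGeometry.Resolution

universe u

/-! ## Kernels and inverse images -/

section Ker

variable {W X Y : Scheme.{u}}

/-- `⊥` pulls back to `⊥`. [folklore] -/
theorem comap_bot (f : X ⟶ Y) : (⊥ : Y.IdealSheafData).comap f = ⊥ :=
  le_bot_iff.mp (Scheme.IdealSheafData.le_map_iff_comap_le.mp bot_le)

/-- The kernel of `f` pulls back to `⊥` along `f`. [folklore] -/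
theorem comap_ker_self (f : X ⟶ Y) : f.ker.comap f = ⊥ := by
  rw [← Scheme.IdealSheafData.map_bot]
  exact le_bot_iff.mp (Scheme.IdealSheafData.comap_map_le ⊥ f)

/-- An ideal sheaf pulls back to `⊥` on its own closed subscheme. [folklore] -/
theorem comap_subschemeι_self (I : X.IdealSheafData) : I.comap I.subschemeι = ⊥ := by
  have h := comap_ker_self I.subschemeι
  rwa [Scheme.IdealSheafData.ker_subschemeι] at h

/-- `K ⊆ ker g` iff `K` pulls back to `⊥` along `g`. [folklore] -/
theorem le_ker_iff_comap_eq_bot (g : W ⟶ X) (K : X.IdealSheafData) :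
    K ≤ g.ker ↔ K.comap g = ⊥ := by
  rw [← Scheme.IdealSheafData.map_bot, Scheme.IdealSheafData.le_map_iff_comap_le, le_bot_iff]

end Ker

/-! ## Effective Cartier divisors are nonzerodivisors on ideal sheaves -/

section Cartier

variable {X : Scheme.{u}}

/-- If `P` is an effective Cartier divisor and `P · K = 0` then `K = 0`. [folklore] -/
theorem IsEffectiveCartier.eq_bot_of_mul_eq_bot {P K : X.IdealSheafData} (hP : IsEffectiveCartier P)
    (h : P * K = ⊥) : K = ⊥ := by
  choose U hxU g hg hPU using hP
  have hcov : ⨆ x, (U x : X.Opens) = ⊤ :=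
    top_le_iff.mp fun x _ => Opens.mem_iSup.mpr ⟨x, hxU x⟩
  refine Scheme.IdealSheafData.ext_of_iSup_eq_top U hcov fun x => ?_
  rw [Scheme.IdealSheafData.ideal_bot, Pi.bot_apply]
  refine le_bot_iff.mp fun k hk => ?_
  have hmem : g x * k ∈ (P * K).ideal (U x) := by
    rw [Scheme.IdealSheafData.ideal_mul, Pi.mul_apply, hPU]
    exact Ideal.mul_mem_mul (Ideal.mem_span_singleton_self _) hk
  rw [h, Scheme.IdealSheafData.ideal_bot, Pi.bot_apply, Ideal.mem_bot] at hmem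
  exact (mem_nonZeroDivisors_iff_right.mp (hg x)) _ (by rw [mul_comm]; exact hmem)

end Cartier

/-! ## The local argument: the equation of `D` is a nonzerodivisor modulo `H'` -/

section Local

variable {X X' : Scheme.{u}} [IsLocallyNoetherian X] {π : X' ⟶ X} {C H : X.IdealSheafData}

/-- **The equation of the exceptional divisor is a nonzerodivisor modulo `H'` on an affine open.**
With hypotheses as in `IsBlowup.exists_generator_controlledTransform_hypersurface`, on an affine
open `V ⊆ X'` where `𝓘(D) = (g₀)`: if `s g₀ ∈ H'(V)` then `s ∈ H'(V)` (check at the stalks: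
`𝒪_{X',y}/H'_y = 𝒪_{X',y}/(w)` is a domain in which `g₀ ≠ 0`). [folklore] -/
theorem mem_ideal_of_mul_mem_of_hypersurface (hX : Scheme.IsRegular X) (hπ : IsBlowup π C)
    (hC : Scheme.IsRegular C.subscheme) (hHC : H ≤ C)
    (hH : ∀ x ∈ H.support, ∃ v : X.presheaf.stalk x,
      stalkIdeal H x = Ideal.span {v} ∧ v ∉ (maximalIdeal (X.presheaf.stalk x)) ^ 2)
    (V : X'.affineOpens) {g₀ : Γ(X', V)} (hDV : (C.comap π).ideal V = Ideal.span {g₀})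
    {s : Γ(X', V)} (hs : s * g₀ ∈ (controlledTransform π C H 1).ideal V) :
    s ∈ (controlledTransform π C H 1).ideal V := by
  have hX' : Scheme.IsRegular X' := hπ.isRegular_of_isRegular_subscheme hX hC
  refine Ideal.mem_of_localization_maximal fun P hP => ?_
  -- the point `y ∈ V` of the maximal ideal `P`
  let p : PrimeSpectrum Γ(X', V) := ⟨P, hP.isPrime⟩
  have hy : V.2.fromSpec p ∈ (V : X'.Opens) := V.2.range_fromSpec.le ⟨p, rfl⟩
  letI alg : Algebra Γ(X', V) (X'.presheaf.stalk (V.2.fromSpec p)) :=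
    (X'.presheaf.germ V _ hy).hom.toAlgebra
  haveI : IsLocalization.AtPrime (X'.presheaf.stalk (V.2.fromSpec p)) P :=
    V.2.isLocalization_stalk' p hy
  -- it suffices to check `germ s ∈ H'_y`
  suffices hst : (X'.presheaf.germ V _ hy).hom s ∈ stalkIdeal (controlledTransform π C H 1)
      (V.2.fromSpec p) by
    let ε := (IsLocalization.algEquiv P.primeCompl (X'.presheaf.stalk (V.2.fromSpec p))
      (Localization.AtPrime P))
    have h1 : ((stalkIdeal (controlledTransform π C H 1) (V.2.fromSpec p)).map ε.toRingEquiv.toRingHom) =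
        ((controlledTransform π C H 1).ideal V).map (algebraMap _ (Localization.AtPrime P)) := by
      rw [stalkIdeal_eq_map_germ _ V hy, Ideal.map_map]
      congr 1
      ext a
      exact ε.commutes a
    rw [← h1]
    have h2 : algebraMap Γ(X', V) (Localization.AtPrime P) s =
        ε.toRingEquiv.toRingHom ((X'.presheaf.germ V _ hy).hom s) := (ε.commutes s).symm
    rw [h2]
    exact Ideal.mem_map_of_mem _ hst
  by_cases hyH : V.2.fromSpec p ∈ (controlledTransform π C H 1).support
  swap
  · rw [stalkIdeal_eq_top_of_not_mem_support hyH]; trivial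
  obtain ⟨w, hw, hw2, hnot⟩ :=
    hπ.exists_generator_controlledTransform_hypersurface hX hC hHC hH _ hyH
  -- `𝒪_y/(w)` is a regular local ring, a domain, and `germ g₀ ∉ (w)`
  haveI : IsRegularLocalRing (X'.presheaf.stalk (V.2.fromSpec p)) := hX' _
  have hwm : w ∈ maximalIdeal _ :=
    (Ideal.span_singleton_le_iff_mem _).mp (hw ▸ (mem_support_iff_stalkIdeal_le _ _).mp hyH)
  haveI := (IsRegularLocalRing.quotient_span_singleton hwm hw2).1
  haveI : IsDomain (X'.presheaf.stalk (V.2.fromSpec p) ⧸ Ideal.span {w}) :=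
    isDomain_of_isRegularLocalRing _
  have hg₀ : (X'.presheaf.germ V _ hy).hom g₀ ∉ Ideal.span {w} := by
    intro hmem
    apply hnot
    rw [stalkIdeal_eq_map_germ _ V hy, hDV, Ideal.map_span, Set.image_singleton,
      Ideal.span_singleton_le_iff_mem]
    exact hmem
  have hprod : (X'.presheaf.germ V _ hy).hom s * (X'.presheaf.germ V _ hy).hom g₀ ∈ Ideal.span {w} := by
    rw [← map_mul, ← hw, stalkIdeal_eq_map_germ _ V hy]
    exact Ideal.mem_map_of_mem _ hs
  rw [hw]
  have h0 : Ideal.Quotient.mk (Ideal.span {w}) ((X'.presheaf.germ V _ hy).hom s) *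
      Ideal.Quotient.mk (Ideal.span {w}) ((X'.presheaf.germ V _ hy).hom g₀) = 0 := by
    rw [← map_mul, Ideal.Quotient.eq_zero_iff_mem]
    exact hprod
  have hne : Ideal.Quotient.mk (Ideal.span {w}) ((X'.presheaf.germ V _ hy).hom g₀) ≠ 0 := fun h =>
    hg₀ (Ideal.Quotient.eq_zero_iff_mem.mp h)
  exact Ideal.Quotient.eq_zero_iff_mem.mp ((mul_eq_zero.mp h0).resolve_right hne)

/-- **The exceptional divisor restricts to an effective Cartier divisor on `V(H')`.**
[cite: BierstoneGrigorievMilmanWlodarczyk2011, Lemma 3.6.4 (6)] -/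
theorem IsBlowup.isEffectiveCartier_comap_subschemeι_controlledTransform (hX : Scheme.IsRegular X)
    (hπ : IsBlowup π C) (hC : Scheme.IsRegular C.subscheme) (hHC : H ≤ C)
    (hH : ∀ x ∈ H.support, ∃ v : X.presheaf.stalk x,
      stalkIdeal H x = Ideal.span {v} ∧ v ∉ (maximalIdeal (X.presheaf.stalk x)) ^ 2) :
    IsEffectiveCartier ((C.comap π).comap (controlledTransform π C H 1).subschemeι) := by
  intro s
  obtain ⟨V, hxV, g₀, hg₀, hDV⟩ :=
    hπ.isEffectiveCartier ((controlledTransform π C H 1).subschemeι s)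
  let U' : (controlledTransform π C H 1).subscheme.affineOpens :=
    ⟨(controlledTransform π C H 1).subschemeι ⁻¹ᵁ (V : X'.Opens), V.2.preimage _⟩
  have hsU' : s ∈ (U' : (controlledTransform π C H 1).subscheme.Opens) := hxV
  refine ⟨U', hsU', (controlledTransform π C H 1).subschemeι.app V g₀, ?_, ?_⟩
  · -- nonzerodivisor
    rw [mem_nonZeroDivisors_iff_right]
    intro y hy
    obtain ⟨s₁, rfl⟩ := (controlledTransform π C H 1).subschemeι_app_surjective V y
    have hmem : s₁ * g₀ ∈ RingHom.ker ((controlledTransform π C H 1).subschemeι.app V).hom := by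
      rw [RingHom.mem_ker, map_mul]
      exact hy
    rw [Scheme.IdealSheafData.ker_subschemeι_app] at hmem
    have hs₁ := mem_ideal_of_mul_mem_of_hypersurface hX hπ hC hHC hH V hDV hmem
    rw [← Scheme.IdealSheafData.ker_subschemeι_app (controlledTransform π C H 1) V] at hs₁
    exact hs₁
  · -- the ideal
    rw [ideal_comap_of_le (controlledTransform π C H 1).subschemeι (C.comap π) V U' le_rfl, hDV,
      Ideal.map_span, Set.image_singleton, ← Scheme.Hom.app_eq_appLE]

end Local

/-! ## The restriction property -/

section Restriction

variable {X X' : Scheme.{u}} [IsLocallyNoetherian X] {π : X' ⟶ X} {C H : X.IdealSheafData}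

omit [IsLocallyNoetherian X] in
/-- **The morphism `V(H') → V(H)` induced by the blow-up exists** (`π^*H ⊆ H'`).
[cite: BierstoneGrigorievMilmanWlodarczyk2011, Lemma 3.6.4 (6)] -/
theorem exists_hom_subscheme_controlledTransform (π : X' ⟶ X) (C H : X.IdealSheafData) :
    ∃ πS : (controlledTransform π C H 1).subscheme ⟶ H.subscheme,
      πS ≫ H.subschemeι = (controlledTransform π C H 1).subschemeι ≫ π := by
  have hker : H.subschemeι.ker ≤ ((controlledTransform π C H 1).subschemeι ≫ π).ker := by
    rw [Scheme.IdealSheafData.ker_subschemeι, le_ker_iff_comap_eq_bot,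
      Scheme.IdealSheafData.comap_comp]
    refine le_bot_iff.mp ?_
    calc (H.comap π).comap (controlledTransform π C H 1).subschemeι
        ≤ (controlledTransform π C H 1).comap (controlledTransform π C H 1).subschemeι :=
          Scheme.IdealSheafData.comap_mono (f := (controlledTransform π C H 1).subschemeι)
            (comap_le_controlledTransform π C H 1)
      _ = ⊥ := comap_subschemeι_self _
  exact ⟨IsClosedImmersion.lift _ _ hker, IsClosedImmersion.lift_fac _ _ hker⟩

/-- **The restriction property (BGMW §4 Remark (3); Lemma 3.6.4 (6)) for a regular hypersurface
through the centre.** Let `X` be locally Noetherian and regular, `π : X' → X` a blow-up along `C`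
with `V(C)` regular, and `H ⊆ C` an ideal sheaf generated at each point of `V(H)` by an element
of order one (a regular hypersurface `Y = V(H) ⊇ V(C)`). Then every morphism
`πS : V(H') → V(H)` over `π`, `H' = (π^*H : 𝓘(D))` the controlled transform of the hypersurface
(`V(H') = V(u')`, which therefore is the strict transform of `V(H)`), is a blow-up of `V(H)`
along `C|_{V(H)}` — "the blow-up `σ_{C,Y} : Ỹ → Y` at `C` coincides with the strict transform of
`Y` under the blow-up `σ_{C,X}`". [cite: BierstoneGrigorievMilmanWlodarczyk2011, §4 Remark (3)] -/
theorem IsBlowup.isBlowup_subscheme_controlledTransform (hX : Scheme.IsRegular X)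
    (hπ : IsBlowup π C) (hC : Scheme.IsRegular C.subscheme) (hHC : H ≤ C)
    (hH : ∀ x ∈ H.support, ∃ v : X.presheaf.stalk x,
      stalkIdeal H x = Ideal.span {v} ∧ v ∉ (maximalIdeal (X.presheaf.stalk x)) ^ 2)
    (πS : (controlledTransform π C H 1).subscheme ⟶ H.subscheme)
    (hπS : πS ≫ H.subschemeι = (controlledTransform π C H 1).subschemeι ≫ π) :
    IsBlowup πS (C.comap H.subschemeι) := by
  haveI : IsProper π := hπ.isProper
  haveI : IsLocallyNoetherian X' := LocallyOfFiniteType.isLocallyNoetherian π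
  constructor
  · -- the exceptional locus on `V(H')` is effective Cartier
    rw [← Scheme.IdealSheafData.comap_comp, hπS, Scheme.IdealSheafData.comap_comp]
    exact hπ.isEffectiveCartier_comap_subschemeι_controlledTransform hX hC hHC hH
  · -- universality
    intro W f hf
    have hf' : IsEffectiveCartier (C.comap (f ≫ H.subschemeι)) := by
      rwa [Scheme.IdealSheafData.comap_comp]
    obtain ⟨g, hg, hgu⟩ := hπ.universal (f ≫ H.subschemeι) hf'
    -- `g` lands in `V(H')`
    have hDg : IsEffectiveCartier ((C.comap π).comap g) := by
      rwa [← Scheme.IdealSheafData.comap_comp, hg]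
    have hprod : (C.comap π).comap g * (controlledTransform π C H 1).comap g = ⊥ := by
      rw [← comap_mul]
      have hle : H.comap π ≤ C.comap π ^ 1 := by
        rw [pow_one]
        exact Scheme.IdealSheafData.comap_mono (f := π) hHC
      have h := pow_mul_controlledTransform_eq π C (I := H) (μ := 1) hπ.isEffectiveCartier hle
      rw [pow_one] at h
      rw [h, ← Scheme.IdealSheafData.comap_comp, hg, Scheme.IdealSheafData.comap_comp,
        comap_subschemeι_self, comap_bot]
    have hle : (controlledTransform π C H 1).subschemeι.ker ≤ g.ker := by
      rw [Scheme.IdealSheafData.ker_subschemeι, le_ker_iff_comap_eq_bot]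
      exact hDg.eq_bot_of_mul_eq_bot hprod
    refine ⟨IsClosedImmersion.lift (controlledTransform π C H 1).subschemeι g hle, ?_, ?_⟩
    · show IsClosedImmersion.lift (controlledTransform π C H 1).subschemeι g hle ≫ πS = f
      rw [← cancel_mono H.subschemeι, Category.assoc, hπS, IsClosedImmersion.lift_fac_assoc, hg]
    · intro g' hg'
      change g' ≫ πS = f at hg'
      rw [← cancel_mono (controlledTransform π C H 1).subschemeι, IsClosedImmersion.lift_fac]
      apply hgu
      show (g' ≫ (controlledTransform π C H 1).subschemeι) ≫ π = f ≫ H.subschemeι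
      rw [Category.assoc, ← hπS, ← Category.assoc, hg']

end Restriction

end Literature.AlgebraicGeometry.Resolution

end
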